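import Literature.NumberTheory.LFunctions.SiegelWalfiszLiouville
import Literature.NumberTheory.LFunctions.MoebiusHarmonicSumBound
import HarnessLib

/-!
# `∑_{n ≤ x} λ(n)/n ≪ exp(−c √log x)` for the Liouville function

Topic `Literature/NumberTheory/LFunctions`. Everything in this file is PROVED. From the tree's
`∑_{n ≤ y} μ(n)/n ≪ exp(−c₁√log y)` (`abs_sum_moebius_div_le_exp_neg_sqrt_log`,
`MoebiusHarmonicSumBound.lean`) and `λ = 𝟙_□ ⋆ μ` we derive the same estimate for the Liouville
function `λ` (Mathlib's `ArithmeticFunction.liouville`):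

* `LiouvilleSum.sum_liouville_div_eq` — `∑_{n ≤ N} λ(n)/n = ∑_{a ≤ N} 𝟙_□(a) a⁻¹ ∑_{m ≤ N/a} μ(m)/m`
  (Dirichlet's rearrangement, the tree's `SiegelWalfiszLiouville.sum_Ioc_sum_divisorsAntidiagonal_eq`);
* `abs_sum_liouville_div_le_exp_neg_sqrt_log` — there are `c > 0`, `C` with
  `|∑_{n ≤ x} λ(n)/n| ≤ C exp(−c√log x)` for all `x ≥ 2` (squares `a ≤ √x` through the Möbius
  bound at `x/a ≥ √x`, the others through `|∑_{m ≤ y} μ(m)/m| ≤ 1 + log y` and `∑_{r > R} r⁻² ≤ 1/R`);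
* `tendsto_sum_liouville_div_zero` — `∑_{n ≤ N} λ(n)/n → 0`, i.e. `∑ λ(n)/n = 0`
  (`= ζ(2s)/ζ(s)` at `s = 1`; Landau).

This is the input "`∑_{n ≤ N/d} λ_L(n)/n`" of the evaluation of the main term in Matomäki–Merikoski,
arXiv:2112.11412, §6 (proof of Lemma 2.4), in real-variable form (the source uses Perron's formula).

## References

* H. L. Montgomery, R. C. Vaughan, *Multiplicative Number Theory I*, CUP 2007, §6.2 (Theorem 6.9)
  and §6.2.1 Exercise 11. [cite: MontgomeryVaughan2007, §6.2.1 Exercise 11]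
* K. Matomäki, J. Merikoski, IMRN 2023 (arXiv:2112.11412), §6. [cite: MatomakiMerikoski2023, §6]
-/

noncomputable section

open Finset Real Filter ArithmeticFunction
open scoped ArithmeticFunction.Moebius

namespace Literature.NumberTheory.LFunctions

namespace LiouvilleSum

open SiegelWalfiszLiouville

/-! ### Dirichlet's rearrangement for `∑ λ(n)/n` -/

/-- **`∑_{n ≤ N} λ(n)/n = ∑_{a ≤ N} 𝟙_□(a) · a⁻¹ · ∑_{m ≤ N/a} μ(m)/m`** (`λ = 𝟙_□ ⋆ μ`).
[folklore] -/
theorem sum_liouville_div_eq (N : ℕ) :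
    ∑ n ∈ Icc 1 N, (liouville n : ℝ) / n =
      ∑ a ∈ Ioc 0 N, (if IsSquare a then (1 : ℝ) else 0) *
        ((a : ℝ)⁻¹ * ∑ m ∈ Icc 1 (N / a), (μ m : ℝ) / m) := by
  have hIcc : ∀ M : ℕ, Icc 1 M = Ioc 0 M := fun M => rfl
  rw [hIcc]
  have h1 : ∀ n ∈ Ioc 0 N, (liouville n : ℝ) / n =
      ∑ x ∈ n.divisorsAntidiagonal,
        (if IsSquare x.1 then (1 : ℝ) else 0) * ((x.1 : ℝ)⁻¹ * ((μ x.2 : ℝ) / x.2)) := by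
    intro n _
    rw [liouville_eq_sum_antidiagonal n, sum_div]
    refine sum_congr rfl fun x hx => ?_
    rw [Nat.mem_divisorsAntidiagonal] at hx
    rw [← hx.1, Nat.cast_mul]
    have h1 : (x.1 : ℝ) ≠ 0 := by
      have := left_ne_zero_of_mul (hx.1.symm ▸ hx.2)
      exact_mod_cast this
    have h2 : (x.2 : ℝ) ≠ 0 := by
      have := right_ne_zero_of_mul (hx.1.symm ▸ hx.2)
      exact_mod_cast this
    field_simp
  rw [sum_congr rfl h1, sum_Ioc_sum_divisorsAntidiagonal_eq
    (fun a m => (if IsSquare a then (1 : ℝ) else 0) * ((a : ℝ)⁻¹ * ((μ m : ℝ) / m))) N]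
  refine sum_congr rfl fun a _ => ?_
  rw [hIcc, mul_sum, mul_sum]

/-! ### Elementary bounds -/

/-- `|∑_{m ≤ M} μ(m)/m| ≤ 1 + log M` (harmonic sum; both sides vanish at `M = 0`). [folklore] -/
theorem abs_sum_moebius_div_le_one_add_log (M : ℕ) :
    |∑ m ∈ Icc 1 M, (μ m : ℝ) / m| ≤ 1 + Real.log M := by
  calc |∑ m ∈ Icc 1 M, (μ m : ℝ) / m| ≤ ∑ m ∈ Icc 1 M, |(μ m : ℝ) / m| := abs_sum_le_sum_abs _ _
    _ ≤ ∑ m ∈ Icc 1 M, (m : ℝ)⁻¹ := sum_le_sum fun m hm => by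
        have hm0 : (0 : ℝ) < m := by exact_mod_cast (mem_Icc.mp hm).1
        rw [abs_div, abs_of_pos hm0, div_le_iff₀ hm0, inv_mul_cancel₀ hm0.ne']
        exact_mod_cast ArithmeticFunction.abs_moebius_le_one
    _ = ∑ m ∈ Ioc 0 M, (m : ℝ)⁻¹ := rfl
    _ ≤ 1 + Real.log M := LiouvilleSum.sum_Ioc_inv_le_one_add_log M

/-- Sums of a nonnegative `f` over the squares of `(A, B]` are sums over `(√A, √B]`:
`∑_{A < a ≤ B} 𝟙_□(a) f(a) ≤ ∑_{√A < r ≤ √B} f(r²)`. [folklore] -/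
theorem sum_Ioc_indicator_isSquare_mul_le {f : ℕ → ℝ} (hf : ∀ a, 0 ≤ f a) (A B : ℕ) :
    ∑ a ∈ Ioc A B, (if IsSquare a then (1 : ℝ) else 0) * f a ≤
      ∑ r ∈ Ioc (Nat.sqrt A) (Nat.sqrt B), f (r * r) := by
  have h1 : ∑ a ∈ Ioc A B, (if IsSquare a then (1 : ℝ) else 0) * f a =
      ∑ a ∈ (Ioc A B).filter IsSquare, f a := by
    rw [sum_filter]
    refine sum_congr rfl fun a _ => ?_
    split_ifs <;> simp
  have hsub : (Ioc A B).filter IsSquare ⊆ (Ioc (Nat.sqrt A) (Nat.sqrt B)).image fun r => r * r := by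
    intro a ha
    rw [mem_filter, mem_Ioc] at ha
    obtain ⟨⟨hAa, haB⟩, r, rfl⟩ := ha
    rw [mem_image]
    refine ⟨r, mem_Ioc.mpr ⟨?_, Nat.le_sqrt.mpr haB⟩, rfl⟩
    by_contra hr
    rw [not_lt] at hr
    have : r * r ≤ Nat.sqrt A * Nat.sqrt A := Nat.mul_le_mul hr hr
    have := Nat.sqrt_le A
    omega
  have hinj : Set.InjOn (fun r : ℕ => r * r) ↑(Ioc (Nat.sqrt A) (Nat.sqrt B)) :=
    fun r _ s _ h => Nat.mul_self_inj.mp h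
  rw [h1]
  calc ∑ a ∈ (Ioc A B).filter IsSquare, f a
      ≤ ∑ a ∈ (Ioc (Nat.sqrt A) (Nat.sqrt B)).image (fun r => r * r), f a :=
        sum_le_sum_of_subset_of_nonneg hsub fun a _ _ => hf a
    _ = ∑ r ∈ Ioc (Nat.sqrt A) (Nat.sqrt B), f (r * r) := sum_image hinj

/-- `∑_{a ≤ B} 𝟙_□(a)/a ≤ 2`. [folklore] -/
theorem sum_indicator_isSquare_div_le_two (B : ℕ) :
    ∑ a ∈ Ioc 0 B, (if IsSquare a then (1 : ℝ) else 0) * (a : ℝ)⁻¹ ≤ 2 := by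
  refine (sum_Ioc_indicator_isSquare_mul_le (fun a => inv_nonneg.mpr (Nat.cast_nonneg a)) 0 B).trans ?_
  rw [Nat.sqrt_zero]
  refine le_trans (le_of_eq ?_) (sum_Ioc_inv_sq_le_two (Nat.sqrt B))
  refine sum_congr rfl fun r _ => ?_
  rw [Nat.cast_mul, one_div, sq]

/-- `∑_{A < a ≤ B} 𝟙_□(a)/a ≤ 1/√A` for `A ≥ 1` (`∑_{r > R} r⁻² ≤ 1/R`). [folklore] -/
theorem sum_indicator_isSquare_div_le_inv_sqrt {A : ℕ} (hA : 1 ≤ A) (B : ℕ) :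
    ∑ a ∈ Ioc A B, (if IsSquare a then (1 : ℝ) else 0) * (a : ℝ)⁻¹ ≤ 1 / (Nat.sqrt A : ℝ) := by
  refine (sum_Ioc_indicator_isSquare_mul_le (fun a => inv_nonneg.mpr (Nat.cast_nonneg a)) A B).trans ?_
  have hR : 1 ≤ Nat.sqrt A := Nat.le_sqrt.mpr (by simpa using hA)
  refine le_trans (le_of_eq ?_) (sum_Ioc_inv_sq_le hR (Nat.sqrt B))
  refine sum_congr rfl fun r _ => ?_
  rw [Nat.cast_mul, one_div, sq]

/-- Patching an eventual bound `|g(x)| ≤ C e^{−c√log x}` (`x ≥ X₀`) with the trivial bound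
`|g(x)| ≤ x` on `[2, X₀]`. [folklore] -/
theorem forall_two_le_of_forall_ge_exp {g : ℝ → ℝ} (hg : ∀ x, 2 ≤ x → |g x| ≤ x)
    {c C X₀ : ℝ} (h : ∀ x, X₀ ≤ x → |g x| ≤ C * Real.exp (-c * Real.sqrt (Real.log x))) :
    ∃ C' : ℝ, ∀ x, 2 ≤ x → |g x| ≤ C' * Real.exp (-c * Real.sqrt (Real.log x)) := by
  set X₁ : ℝ := max X₀ 2 with hX₁
  set m : ℝ := Real.exp (-|c| * Real.sqrt (Real.log X₁)) with hm
  have hm0 : 0 < m := Real.exp_pos _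
  have hX₁0 : 0 ≤ X₁ := le_trans zero_le_two (le_max_right _ _)
  refine ⟨max C 0 + X₁ * m⁻¹, fun x hx => ?_⟩
  have hE0 : 0 < Real.exp (-c * Real.sqrt (Real.log x)) := Real.exp_pos _
  rcases le_or_gt X₀ x with hxX | hxX
  · calc |g x| ≤ C * Real.exp (-c * Real.sqrt (Real.log x)) := h x hxX
      _ ≤ (max C 0 + X₁ * m⁻¹) * Real.exp (-c * Real.sqrt (Real.log x)) := by
          gcongr
          linarith [le_max_left C 0, mul_nonneg hX₁0 (inv_pos.mpr hm0).le]
  · have hxX₁ : x ≤ X₁ := hxX.le.trans (le_max_left _ _)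
    have hmx : m ≤ Real.exp (-c * Real.sqrt (Real.log x)) := by
      refine Real.exp_le_exp.mpr ?_
      have h1 : Real.sqrt (Real.log x) ≤ Real.sqrt (Real.log X₁) :=
        Real.sqrt_le_sqrt (Real.log_le_log (by linarith) hxX₁)
      have h2 : 0 ≤ Real.sqrt (Real.log x) := Real.sqrt_nonneg _
      have h3 : -|c| * Real.sqrt (Real.log x) ≤ -c * Real.sqrt (Real.log x) :=
        mul_le_mul_of_nonneg_right (neg_le_neg (le_abs_self c)) h2
      have h4 : -|c| * Real.sqrt (Real.log X₁) ≤ -|c| * Real.sqrt (Real.log x) :=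
        mul_le_mul_of_nonpos_left h1 (by simp [abs_nonneg])
      linarith
    calc |g x| ≤ x := hg x hx
      _ ≤ X₁ := hxX₁
      _ = X₁ * m⁻¹ * m := by field_simp
      _ ≤ X₁ * m⁻¹ * Real.exp (-c * Real.sqrt (Real.log x)) := by gcongr
      _ ≤ (max C 0 + X₁ * m⁻¹) * Real.exp (-c * Real.sqrt (Real.log x)) := by
          gcongr
          linarith [le_max_right C 0]

/-- The trivial bound `|∑_{n ≤ x} λ(n)/n| ≤ x` for `x ≥ 2` (indeed `≤ 1 + log x`). [folklore] -/
theorem abs_sum_liouville_div_le_self {x : ℝ} (hx : 2 ≤ x) :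
    |∑ n ∈ Icc 1 ⌊x⌋₊, (liouville n : ℝ) / n| ≤ x := by
  have hx0 : 0 < x := by linarith
  have hN1 : 1 ≤ ⌊x⌋₊ := Nat.le_floor (by norm_num; linarith)
  calc |∑ n ∈ Icc 1 ⌊x⌋₊, (liouville n : ℝ) / n| ≤ ∑ n ∈ Icc 1 ⌊x⌋₊, |(liouville n : ℝ) / n| :=
        abs_sum_le_sum_abs _ _
    _ ≤ ∑ n ∈ Icc 1 ⌊x⌋₊, (n : ℝ)⁻¹ := sum_le_sum fun n hn => by
        have hn0 : (0 : ℝ) < n := by exact_mod_cast (mem_Icc.mp hn).1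
        rw [abs_div, abs_of_pos hn0, div_le_iff₀ hn0, inv_mul_cancel₀ hn0.ne']
        exact LiouvilleSum.abs_liouville_le_one n
    _ = ∑ n ∈ Ioc 0 ⌊x⌋₊, (n : ℝ)⁻¹ := rfl
    _ ≤ 1 + Real.log ⌊x⌋₊ := LiouvilleSum.sum_Ioc_inv_le_one_add_log _
    _ ≤ 1 + Real.log x := by
        have h0 : (0 : ℝ) < ⌊x⌋₊ := by exact_mod_cast hN1
        linarith [Real.log_le_log h0 (Nat.floor_le hx0.le)]
    _ ≤ x := by
        have := Real.add_one_le_exp (Real.log x)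
        rw [Real.exp_log hx0] at this
        linarith

/-! ### The estimate -/

/-- The core estimate for large `x`: with `c₀ ≤ 1/4` and `C₀ ≥ 0` such that
`|∑_{m ≤ y} μ(m)/m| ≤ C₀ e^{−c₀√log y}` for `y ≥ 2`, one has
`|∑_{n ≤ x} λ(n)/n| ≤ (2C₀ + 16) e^{−(c₀/2)√log x}` for `x ≥ 16`. [folklore] -/
theorem abs_sum_liouville_div_le_of_bound {c₀ C₀ : ℝ} (hc₀ : 0 < c₀) (hc₀' : c₀ ≤ 1 / 4)
    (hC₀ : 0 ≤ C₀)
    (hm : ∀ y : ℝ, 2 ≤ y → |∑ m ∈ Icc 1 ⌊y⌋₊, (μ m : ℝ) / m| ≤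
      C₀ * Real.exp (-c₀ * Real.sqrt (Real.log y))) {x : ℝ} (hx : 16 ≤ x) :
    |∑ n ∈ Icc 1 ⌊x⌋₊, (liouville n : ℝ) / n| ≤
      (2 * C₀ + 16) * Real.exp (-(c₀ / 2) * Real.sqrt (Real.log x)) := by
  have hx0 : 0 < x := by linarith
  have hx1 : 1 ≤ x := by linarith
  set L : ℝ := Real.log x with hLdef
  have hL1 : 1 ≤ L := by
    rw [hLdef, ← Real.log_exp 1]
    exact Real.log_le_log (Real.exp_pos 1) (by have := Real.exp_one_lt_d9; linarith)
  have hL0 : 0 < L := by linarith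
  set u : ℝ := Real.sqrt L with hudef
  have hu1 : 1 ≤ u := by rw [hudef, ← Real.sqrt_one]; exact Real.sqrt_le_sqrt hL1
  have huL : u ^ 2 = L := Real.sq_sqrt hL0.le
  have huL' : u ≤ L := by nlinarith
  -- `√x ≥ 4`
  have hsx : 4 ≤ Real.sqrt x := by
    rw [show (4 : ℝ) = Real.sqrt 16 by rw [show (16 : ℝ) = 4 ^ 2 by norm_num,
      Real.sqrt_sq (by norm_num)]]
    exact Real.sqrt_le_sqrt hx
  have hsx0 : 0 < Real.sqrt x := by linarith
  have hsxx : Real.sqrt x ≤ x := by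
    rw [Real.sqrt_le_left hx0.le]
    nlinarith
  have hxsx : x / Real.sqrt x = Real.sqrt x := by
    rw [div_eq_iff hsx0.ne', Real.mul_self_sqrt hx0.le]
  set N : ℕ := ⌊x⌋₊ with hN
  set A₀ : ℕ := ⌊Real.sqrt x⌋₊ with hA₀
  have hA₀le : (A₀ : ℝ) ≤ Real.sqrt x := Nat.floor_le hsx0.le
  have hA₀N : A₀ ≤ N := Nat.floor_le_floor hsxx
  have hA₀1 : 1 ≤ A₀ := Nat.le_floor (by norm_num; linarith)
  -- the rearranged sum, split at `A₀`
  rw [sum_liouville_div_eq N, ← sum_Ioc_consecutive _ (Nat.zero_le A₀) hA₀N]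
  refine (abs_add_le _ _).trans ?_
  have hg0 : ∀ a : ℕ, (0 : ℝ) ≤ if IsSquare a then (1 : ℝ) else 0 := fun a => by
    split_ifs <;> norm_num
  -- Part 1: squares `a ≤ A₀ ≤ √x`, Möbius bound at `x/a ≥ √x`
  set E : ℝ := Real.exp (-(c₀ / 2) * u) with hEdef
  have hterm1 : ∀ a ∈ Ioc 0 A₀,
      |(if IsSquare a then (1 : ℝ) else 0) * ((a : ℝ)⁻¹ * ∑ m ∈ Icc 1 (N / a), (μ m : ℝ) / m)| ≤
        C₀ * E * ((if IsSquare a then (1 : ℝ) else 0) * (a : ℝ)⁻¹) := by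
    intro a ha
    obtain ⟨ha0, haA⟩ := mem_Ioc.mp ha
    have ha0' : (0 : ℝ) < a := by exact_mod_cast ha0
    have hax : (a : ℝ) ≤ Real.sqrt x := le_trans (by exact_mod_cast haA) hA₀le
    have hxa : Real.sqrt x ≤ x / a := by
      rw [← hxsx]
      exact div_le_div_of_nonneg_left hx0.le ha0' hax
    have hxa2 : 2 ≤ x / a := by linarith
    have hxa0 : 0 < x / a := by positivity
    have hM := hm (x / a) hxa2
    rw [Nat.floor_div_natCast] at hM
    -- `√log(x/a) ≥ u/2`
    have hlxa : L / 2 ≤ Real.log (x / a) := by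
      have : Real.log (Real.sqrt x) = L / 2 := by
        rw [hLdef, Real.log_sqrt hx0.le]
      rw [← this]
      exact Real.log_le_log hsx0 hxa
    have hsq : u / 2 ≤ Real.sqrt (Real.log (x / a)) := by
      have h1 : Real.sqrt (L / 2) ≤ Real.sqrt (Real.log (x / a)) := Real.sqrt_le_sqrt hlxa
      have h2 : u / 2 ≤ Real.sqrt (L / 2) := by
        rw [hudef, Real.le_sqrt (by positivity) (by positivity), div_pow, Real.sq_sqrt hL0.le]
        linarith
      linarith
    have hexp : Real.exp (-c₀ * Real.sqrt (Real.log (x / a))) ≤ E := by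
      rw [hEdef]
      exact Real.exp_le_exp.mpr (by nlinarith)
    rw [abs_mul, abs_of_nonneg (hg0 a), abs_mul, abs_of_pos (inv_pos.mpr ha0')]
    calc (if IsSquare a then (1 : ℝ) else 0) * ((a : ℝ)⁻¹ * |∑ m ∈ Icc 1 (N / a), (μ m : ℝ) / m|)
        ≤ (if IsSquare a then (1 : ℝ) else 0) * ((a : ℝ)⁻¹ * (C₀ * E)) := by
          refine mul_le_mul_of_nonneg_left (mul_le_mul_of_nonneg_left ?_ (inv_pos.mpr ha0').le) (hg0 a)
          exact hM.trans (mul_le_mul_of_nonneg_left hexp hC₀)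
      _ = C₀ * E * ((if IsSquare a then (1 : ℝ) else 0) * (a : ℝ)⁻¹) := by ring
  have h1 : |∑ a ∈ Ioc 0 A₀, (if IsSquare a then (1 : ℝ) else 0) *
      ((a : ℝ)⁻¹ * ∑ m ∈ Icc 1 (N / a), (μ m : ℝ) / m)| ≤ 2 * C₀ * E := by
    calc |∑ a ∈ Ioc 0 A₀, (if IsSquare a then (1 : ℝ) else 0) *
          ((a : ℝ)⁻¹ * ∑ m ∈ Icc 1 (N / a), (μ m : ℝ) / m)|
        ≤ ∑ a ∈ Ioc 0 A₀, |(if IsSquare a then (1 : ℝ) else 0) *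
            ((a : ℝ)⁻¹ * ∑ m ∈ Icc 1 (N / a), (μ m : ℝ) / m)| := abs_sum_le_sum_abs _ _
      _ ≤ ∑ a ∈ Ioc 0 A₀, C₀ * E * ((if IsSquare a then (1 : ℝ) else 0) * (a : ℝ)⁻¹) :=
          sum_le_sum hterm1
      _ = C₀ * E * ∑ a ∈ Ioc 0 A₀, (if IsSquare a then (1 : ℝ) else 0) * (a : ℝ)⁻¹ := by
          rw [mul_sum]
      _ ≤ C₀ * E * 2 :=
          mul_le_mul_of_nonneg_left (sum_indicator_isSquare_div_le_two A₀) (by positivity)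
      _ = 2 * C₀ * E := by ring
  -- Part 2: squares `a > A₀`, trivial bound and `∑_{r > √A₀} r⁻² ≤ 1/√A₀ ≤ 2 x^{-1/4}`
  have hterm2 : ∀ a ∈ Ioc A₀ N,
      |(if IsSquare a then (1 : ℝ) else 0) * ((a : ℝ)⁻¹ * ∑ m ∈ Icc 1 (N / a), (μ m : ℝ) / m)| ≤
        (1 + L) * ((if IsSquare a then (1 : ℝ) else 0) * (a : ℝ)⁻¹) := by
    intro a ha
    obtain ⟨haA, haN⟩ := mem_Ioc.mp ha
    have ha0 : 0 < a := lt_of_le_of_lt (Nat.zero_le _) haA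
    have ha0' : (0 : ℝ) < a := by exact_mod_cast ha0
    have hMle : |∑ m ∈ Icc 1 (N / a), (μ m : ℝ) / m| ≤ 1 + L := by
      refine (abs_sum_moebius_div_le_one_add_log (N / a)).trans ?_
      rcases Nat.eq_zero_or_pos (N / a) with h0 | hpos
      · rw [h0, Nat.cast_zero, Real.log_zero]
        linarith
      · have : ((N / a : ℕ) : ℝ) ≤ x :=
          calc ((N / a : ℕ) : ℝ) ≤ N := by exact_mod_cast Nat.div_le_self N a
            _ ≤ x := Nat.floor_le hx0.le
        have h0 : (0 : ℝ) < ((N / a : ℕ) : ℝ) := by exact_mod_cast hpos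
        linarith [Real.log_le_log h0 this]
    rw [abs_mul, abs_of_nonneg (hg0 a), abs_mul, abs_of_pos (inv_pos.mpr ha0')]
    calc (if IsSquare a then (1 : ℝ) else 0) * ((a : ℝ)⁻¹ * |∑ m ∈ Icc 1 (N / a), (μ m : ℝ) / m|)
        ≤ (if IsSquare a then (1 : ℝ) else 0) * ((a : ℝ)⁻¹ * (1 + L)) :=
          mul_le_mul_of_nonneg_left (mul_le_mul_of_nonneg_left hMle (inv_pos.mpr ha0').le) (hg0 a)
      _ = (1 + L) * ((if IsSquare a then (1 : ℝ) else 0) * (a : ℝ)⁻¹) := by ring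
  -- `√A₀ ≥ x^{1/4}/2`, in the form `1/Nat.sqrt A₀ ≤ 2 e^{-L/4}`
  have hsqrtA : 1 / (Nat.sqrt A₀ : ℝ) ≤ 2 * Real.exp (-(L / 4)) := by
    set R : ℕ := Nat.sqrt A₀ with hR
    have hR1 : 1 ≤ R := Nat.le_sqrt.mpr (by simpa using hA₀1)
    have hR0 : (0 : ℝ) < R := by exact_mod_cast hR1
    -- `(R+1)^2 ≥ A₀ + 1 > √x`, so `(R+1)^4 > x` and `R + 1 > x^{1/4}`
    have h1 : A₀ + 1 ≤ (R + 1) ^ 2 := by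
      have := Nat.lt_succ_sqrt A₀
      rw [hR]
      nlinarith
    have h2 : Real.sqrt x < (R : ℝ) + 1 + ((R : ℝ) + 1) * R := by
      have h3 : Real.sqrt x < (A₀ : ℝ) + 1 := Nat.lt_floor_add_one _
      have h4 : ((A₀ + 1 : ℕ) : ℝ) ≤ (((R + 1) ^ 2 : ℕ) : ℝ) := by exact_mod_cast h1
      push_cast at h4
      nlinarith
    -- `x^{1/4} = exp(L/4)`; we show `exp(L/4) ≤ 2R`, i.e. `exp(L/2) = √x ≤ 4R²`
    have hexpL2 : Real.exp (L / 2) = Real.sqrt x := by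
      rw [hLdef, Real.sqrt_eq_rpow, Real.rpow_def_of_pos hx0]
      ring_nf
    have h5 : Real.sqrt x ≤ 4 * (R : ℝ) ^ 2 := by
      have hR1' : (1 : ℝ) ≤ R := by exact_mod_cast hR1
      nlinarith
    have h6 : Real.exp (L / 4) ≤ 2 * R := by
      have h7 : Real.exp (L / 4) ^ 2 ≤ (2 * (R : ℝ)) ^ 2 := by
        rw [← Real.exp_nat_mul]
        push_cast
        rw [show (2 : ℝ) * (L / 4) = L / 2 by ring, hexpL2]
        nlinarith
      exact (pow_le_pow_iff_left₀ (Real.exp_pos _).le (by positivity) two_ne_zero).mp h7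
    have h7 : 1 / (R : ℝ) ≤ 2 / Real.exp (L / 4) := by
      rw [div_le_div_iff₀ hR0 (Real.exp_pos _), one_mul]
      exact h6
    calc 1 / (R : ℝ) ≤ 2 / Real.exp (L / 4) := h7
      _ = 2 * Real.exp (-(L / 4)) := by rw [Real.exp_neg, div_eq_mul_inv]
  have h2 : |∑ a ∈ Ioc A₀ N, (if IsSquare a then (1 : ℝ) else 0) *
      ((a : ℝ)⁻¹ * ∑ m ∈ Icc 1 (N / a), (μ m : ℝ) / m)| ≤ 16 * E := by
    calc |∑ a ∈ Ioc A₀ N, (if IsSquare a then (1 : ℝ) else 0) *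
          ((a : ℝ)⁻¹ * ∑ m ∈ Icc 1 (N / a), (μ m : ℝ) / m)|
        ≤ ∑ a ∈ Ioc A₀ N, |(if IsSquare a then (1 : ℝ) else 0) *
            ((a : ℝ)⁻¹ * ∑ m ∈ Icc 1 (N / a), (μ m : ℝ) / m)| := abs_sum_le_sum_abs _ _
      _ ≤ ∑ a ∈ Ioc A₀ N, (1 + L) * ((if IsSquare a then (1 : ℝ) else 0) * (a : ℝ)⁻¹) :=
          sum_le_sum hterm2
      _ = (1 + L) * ∑ a ∈ Ioc A₀ N, (if IsSquare a then (1 : ℝ) else 0) * (a : ℝ)⁻¹ := by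
          rw [mul_sum]
      _ ≤ (1 + L) * (1 / (Nat.sqrt A₀ : ℝ)) :=
          mul_le_mul_of_nonneg_left (sum_indicator_isSquare_div_le_inv_sqrt hA₀1 N) (by positivity)
      _ ≤ (1 + L) * (2 * Real.exp (-(L / 4))) :=
          mul_le_mul_of_nonneg_left hsqrtA (by positivity)
      _ ≤ 16 * E := by
          -- `(1 + L) e^{-L/8} ≤ 8` and `e^{-L/8} ≤ e^{-(c₀/2) u}`
          have h8 : 1 + L ≤ 8 * Real.exp (L / 8) := by
            have := Real.add_one_le_exp (L / 8)
            linarith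
          have hE8 : Real.exp (-(L / 8)) ≤ E := by
            rw [hEdef]
            refine Real.exp_le_exp.mpr ?_
            have : c₀ / 2 * u ≤ L / 8 := by nlinarith
            linarith
          have hsplit : Real.exp (-(L / 4)) = Real.exp (-(L / 8)) * Real.exp (-(L / 8)) := by
            rw [← Real.exp_add]; ring_nf
          have hinv : Real.exp (L / 8) * Real.exp (-(L / 8)) = 1 := by
            rw [← Real.exp_add]; simp
          calc (1 + L) * (2 * Real.exp (-(L / 4)))
              ≤ 8 * Real.exp (L / 8) * (2 * Real.exp (-(L / 4))) :=
                mul_le_mul_of_nonneg_right h8 (by positivity)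
            _ = 16 * (Real.exp (L / 8) * Real.exp (-(L / 8))) * Real.exp (-(L / 8)) := by
                rw [hsplit]; ring
            _ = 16 * Real.exp (-(L / 8)) := by rw [hinv, mul_one]
            _ ≤ 16 * E := mul_le_mul_of_nonneg_left hE8 (by norm_num)
  calc |∑ a ∈ Ioc 0 A₀, (if IsSquare a then (1 : ℝ) else 0) *
          ((a : ℝ)⁻¹ * ∑ m ∈ Icc 1 (N / a), (μ m : ℝ) / m)| +
        |∑ a ∈ Ioc A₀ N, (if IsSquare a then (1 : ℝ) else 0) *
          ((a : ℝ)⁻¹ * ∑ m ∈ Icc 1 (N / a), (μ m : ℝ) / m)|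
      ≤ 2 * C₀ * E + 16 * E := add_le_add h1 h2
    _ = (2 * C₀ + 16) * Real.exp (-(c₀ / 2) * Real.sqrt (Real.log x)) := by
        rw [hEdef]; ring

end LiouvilleSum

open LiouvilleSum in
/-- **`∑_{n ≤ x} λ(n)/n ≪ exp(−c √log x)`** for the Liouville function: there are `c > 0` and
`C` with `|∑_{n ≤ x} λ(n)/n| ≤ C exp(−c√log x)` for all `x ≥ 2`. From the Möbius estimate
`∑_{m ≤ y} μ(m)/m ≪ exp(−c₁√log y)` (`abs_sum_moebius_div_le_exp_neg_sqrt_log`) through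
`∑_{n ≤ x} λ(n)/n = ∑_{a = □ ≤ x} a⁻¹ ∑_{m ≤ x/a} μ(m)/m`.
[cite: MontgomeryVaughan2007, §6.2.1 Exercise 11] -/
theorem abs_sum_liouville_div_le_exp_neg_sqrt_log :
    ∃ c : ℝ, 0 < c ∧ ∃ C : ℝ, ∀ x : ℝ, 2 ≤ x →
      |∑ n ∈ Icc 1 ⌊x⌋₊, (liouville n : ℝ) / n| ≤ C * Real.exp (-c * Real.sqrt (Real.log x)) := by
  obtain ⟨c₁, hc₁, C₁, hm⟩ := abs_sum_moebius_div_le_exp_neg_sqrt_log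
  -- shrink the constants: `c₀ = min c₁ (1/4)`, `C₀ = max C₁ 0`
  set c₀ : ℝ := min c₁ (1 / 4) with hc₀
  set C₀ : ℝ := max C₁ 0 with hC₀
  have hc₀0 : 0 < c₀ := lt_min hc₁ (by norm_num)
  have hc₀' : c₀ ≤ 1 / 4 := min_le_right _ _
  have hm' : ∀ y : ℝ, 2 ≤ y → |∑ m ∈ Icc 1 ⌊y⌋₊, (μ m : ℝ) / m| ≤
      C₀ * Real.exp (-c₀ * Real.sqrt (Real.log y)) := by
    intro y hy
    refine (hm y hy).trans ?_
    have h1 : Real.exp (-c₁ * Real.sqrt (Real.log y)) ≤ Real.exp (-c₀ * Real.sqrt (Real.log y)) :=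
      Real.exp_le_exp.mpr (mul_le_mul_of_nonneg_right (neg_le_neg (min_le_left _ _))
        (Real.sqrt_nonneg _))
    calc C₁ * Real.exp (-c₁ * Real.sqrt (Real.log y)) ≤ C₀ * Real.exp (-c₁ * Real.sqrt (Real.log y)) :=
          mul_le_mul_of_nonneg_right (le_max_left _ _) (Real.exp_pos _).le
      _ ≤ C₀ * Real.exp (-c₀ * Real.sqrt (Real.log y)) :=
          mul_le_mul_of_nonneg_left h1 (le_max_right _ _)
  refine ⟨c₀ / 2, half_pos hc₀0, ?_⟩
  exact forall_two_le_of_forall_ge_exp (fun x hx => abs_sum_liouville_div_le_self hx)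
    fun x hx => abs_sum_liouville_div_le_of_bound hc₀0 hc₀' (le_max_right _ _) hm' hx

open LiouvilleSum in
/-- **`∑_{n=1}^∞ λ(n)/n = 0`**: the partial sums `∑_{n ≤ N} λ(n)/n` tend to `0` (the value of
`ζ(2s)/ζ(s)` at `s = 1`). [cite: MontgomeryVaughan2007, §6.2.1 Exercise 11] -/
theorem tendsto_sum_liouville_div_zero :
    Tendsto (fun N : ℕ => ∑ n ∈ Icc 1 N, (liouville n : ℝ) / n) atTop (nhds 0) := by
  obtain ⟨c, hc, C, h⟩ := abs_sum_liouville_div_le_exp_neg_sqrt_log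
  have hlim : Tendsto (fun N : ℕ => C * Real.exp (-c * Real.sqrt (Real.log N))) atTop
      (nhds (C * 0)) := by
    refine Tendsto.const_mul C ?_
    refine Real.tendsto_exp_atBot.comp ?_
    have h1 : Tendsto (fun N : ℕ => Real.sqrt (Real.log N)) atTop atTop :=
      Real.tendsto_sqrt_atTop.comp (Real.tendsto_log_atTop.comp tendsto_natCast_atTop_atTop)
    exact h1.const_mul_atTop_of_neg (by linarith : -c < 0)
  rw [mul_zero] at hlim
  refine squeeze_zero_norm' ?_ hlim
  filter_upwards [eventually_ge_atTop 2] with N hN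
  rw [Real.norm_eq_abs]
  have := h N (by exact_mod_cast hN)
  rwa [Nat.floor_natCast] at this

end Literature.NumberTheory.LFunctions
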